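import Literature.RepresentationTheory.KonnoKonno2007.RealUnitaryDualPair
import Literature.Geometry.ComplexHyperbolic.UnitBallIsotropyBlock
import HarnessLib

/-!
# The ball-model frame of the junction: `U21 ≃ₜ* U(2,1)` in the diagonal frame `Fin 2 ⊕ Unit` (Konno–Konno 2007 §3.1; Jacobowitz 1990 Ch. 2 §1)

Topic `RepresentationTheory/KonnoKonno2007`; namespace `Literature.RepresentationTheory.KonnoKonno2007.RealDualPair`.
The tree has two avatars of the real group `U(2,1)`:
* `BallModel.U21 = {g ∈ GL₃(ℂ) ∣ gᴴ J g = J}`, `J = diag(1,1,−1)` (`Geometry/ComplexHyperbolic/UnitBallU21`), acting on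
  the ball `𝔹²`, with its block-diagonal maximal compact `blockU : U(2) × U(1) →* U21` (`UnitBallIsotropyBlock`);
* `UForm (Fin 2) Unit = U(⋆, diag(1_{Fin 2}, −1_{Unit})) ≤ GL_{Fin 2 ⊕ Unit}(ℂ)` (`RealUnitaryDualPair`), the first
  member of the junction `Ginf (Fin 2) Unit R S`, with maximal compact `UForm.kV : U(Fin 2) × U(Unit) →* UForm`.

This file identifies them along the reindexing `frameIdx : Fin 3 ≃ Fin 2 ⊕ Unit` (`0,1 ↦ inl 0, inl 1`, `2 ↦ inr ()`):

* `J_eq_submatrix : J = (signForm (Fin 2) Unit).submatrix frameIdx frameIdx`, `U21_eq_unitaryGroupOfForm`;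
* **`u21FrameEquiv : U21 ≃ₜ* UForm (Fin 2) Unit`** (unitary-2's `unitaryGroupOfFormReindex` after `subgroupCongrT`),
  `coe_u21FrameEquiv : matrix = reindex frameIdx frameIdx (mat g)`, `mat_u21FrameEquiv_symm`;
* `unitaryToUnit : unitary ℂ →* Matrix.unitaryGroup Unit ℂ` (`d ↦ (d)`), and the compatibility of the maximal
  compacts **`u21FrameEquiv_blockU : u21FrameEquiv (blockU (A, d)) = UForm.kV (Fin 2) Unit (A, unitaryToUnit d)`**,
  `u21FrameEquiv_blockK`, `u21FrameEquiv_stabilizer` (through G's `stabilizerEquivK21`), `det_unitaryToUnit`.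

All definitions explicit, all statements proved (kernel); group-theoretic content: Konno–Konno 2007 §3.1 (the
diagonal frame of `U(p,q)` and its maximal compact), Jacobowitz 1990 Ch. 2 §1 (`U(2,1) = {A : A*CA = C}`).

## References

* K. Konno, T. Konno (2007), §3.1. [cite: KonnoKonno2007, §3.1]
* H. Jacobowitz, *An Introduction to CR Structures* (1990), Ch. 2 §1 p. 40.

## Provenance

LEAN-IN-TREE rule (2026-08-18), pub-hodgecm model-construction sub-cell, seat mc-theta-2 gen 4: the frame
transport between the ball model's `U21` (home of `ThetaSpaceInput.G₁`, `K₁ = Stab(x₀)`) and the junction's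
`UForm (Fin 2) Unit` (home of the archimedean Weil datum), needed to restrict a junction `ω` to `U21`.
-/

set_option autoImplicit false

noncomputable section

open scoped Matrix MatrixGroups

namespace Literature.RepresentationTheory.KonnoKonno2007

namespace RealDualPair

open Literature.NumberTheory.Automorphic (unitaryGroupOfForm unitaryGroupOfFormReindex
  mem_unitaryGroupOfForm_star_iff_conjTranspose coe_unitaryGroupOfFormReindex_apply)
open Literature.Geometry.ComplexHyperbolic.BallModel (U21 GL3 mat x₀ blockU blockK coe_blockK bmat mat_blockU
  stabilizerEquivK21)
open Literature.NumberTheory.Automorphic.U21 (K21 matA sclD)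

/-! ### § 1. The reindexing `Fin 3 ≃ Fin 2 ⊕ Unit` and the two forms -/

/-- The frame bijection `Fin 3 ≃ Fin 2 ⊕ Unit`: `0 ↦ inl 0`, `1 ↦ inl 1`, `2 ↦ inr ()`. [folklore] -/
def frameIdx : Fin 3 ≃ Fin 2 ⊕ Unit where
  toFun := ![Sum.inl 0, Sum.inl 1, Sum.inr ()]
  invFun := Sum.elim Fin.castSucc fun _ => 2
  left_inv i := by fin_cases i <;> rfl
  right_inv x := by
    rcases x with i | ⟨⟩
    · fin_cases i <;> rfl
    · rfl

/-- `frameIdx 0 = inl 0`. [folklore] -/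
@[simp] theorem frameIdx_zero : frameIdx 0 = Sum.inl 0 := rfl

/-- `frameIdx 1 = inl 1`. [folklore] -/
@[simp] theorem frameIdx_one : frameIdx 1 = Sum.inl 1 := rfl

/-- `frameIdx 2 = inr ()`. [folklore] -/
@[simp] theorem frameIdx_two : frameIdx 2 = Sum.inr () := rfl

/-- `frameIdx⁻¹ (inl i) = i` (as `Fin.castSucc i`). [folklore] -/
@[simp] theorem frameIdx_symm_inl (i : Fin 2) : frameIdx.symm (Sum.inl i) = Fin.castSucc i := rfl

/-- `frameIdx⁻¹ (inr ()) = 2`. [folklore] -/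
@[simp] theorem frameIdx_symm_inr (u : Unit) : frameIdx.symm (Sum.inr u) = 2 := rfl

/-- **`J = diag(1,1,−1)` is the reindexed `signForm (Fin 2) Unit = diag(1_{Fin 2}, −1_{Unit})`.** [folklore] -/
theorem J_eq_submatrix :
    Literature.Geometry.ComplexHyperbolic.BallModel.J = (signForm (Fin 2) Unit).submatrix frameIdx frameIdx := by
  ext i j
  fin_cases i <;> fin_cases j <;>
    simp [Literature.Geometry.ComplexHyperbolic.BallModel.J, Matrix.diagonal]

/-- `U21 = U(⋆, (signForm (Fin 2) Unit).submatrix frameIdx frameIdx)` as subgroups of `GL₃(ℂ)`. [folklore] -/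
theorem U21_eq_unitaryGroupOfForm :
    U21 = unitaryGroupOfForm (starRingEnd ℂ) ((signForm (Fin 2) Unit).submatrix frameIdx frameIdx) := by
  ext g
  rw [mem_unitaryGroupOfForm_star_iff_conjTranspose, ← J_eq_submatrix]
  exact Iff.rfl

/-! ### § 2. The frame isomorphism `U21 ≃ₜ* UForm (Fin 2) Unit` -/

/-- Equal subgroups of a topological group are isomorphic topological groups. [folklore] -/
def subgroupCongrT {G : Type*} [Group G] [TopologicalSpace G] {H K : Subgroup G} (h : H = K) : H ≃ₜ* K :=
  { MulEquiv.subgroupCongr h with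
    continuous_toFun := continuous_induced_rng.2 continuous_subtype_val
    continuous_invFun := continuous_induced_rng.2 continuous_subtype_val }

/-- **The ball-model frame `U21 ≃ₜ* U(2,1)_{Fin 2 ⊕ Unit}`**: `g ↦ reindex frameIdx frameIdx g`.
[cite: KonnoKonno2007, §3.1] -/
def u21FrameEquiv : U21 ≃ₜ* UForm (Fin 2) Unit :=
  (subgroupCongrT U21_eq_unitaryGroupOfForm).trans
    (unitaryGroupOfFormReindex (starRingEnd ℂ) frameIdx (signForm (Fin 2) Unit))

/-- Matrix of `u21FrameEquiv g`: `reindex frameIdx frameIdx (mat g)`. [folklore] -/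
@[simp] theorem coe_u21FrameEquiv (g : U21) :
    (((u21FrameEquiv g : UForm (Fin 2) Unit) : GL (Fin 2 ⊕ Unit) ℂ) : Matrix (Fin 2 ⊕ Unit) (Fin 2 ⊕ Unit) ℂ) =
      Matrix.reindex frameIdx frameIdx (mat g) :=
  rfl

/-- Entries of `u21FrameEquiv g`: `(mat g) (frameIdx⁻¹ x) (frameIdx⁻¹ y)`. [folklore] -/
theorem coe_u21FrameEquiv_apply (g : U21) (x y : Fin 2 ⊕ Unit) :
    (((u21FrameEquiv g : UForm (Fin 2) Unit) : GL (Fin 2 ⊕ Unit) ℂ) : Matrix (Fin 2 ⊕ Unit) (Fin 2 ⊕ Unit) ℂ) x y =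
      mat g (frameIdx.symm x) (frameIdx.symm y) :=
  rfl

/-- Matrix of `u21FrameEquiv.symm u`: `(u : Matrix).submatrix frameIdx frameIdx`. [folklore] -/
@[simp] theorem mat_u21FrameEquiv_symm (u : UForm (Fin 2) Unit) :
    mat (u21FrameEquiv.symm u) =
      ((u : GL (Fin 2 ⊕ Unit) ℂ) : Matrix (Fin 2 ⊕ Unit) (Fin 2 ⊕ Unit) ℂ).submatrix frameIdx frameIdx :=
  rfl

/-! ### § 3. Compatibility of the maximal compacts -/

/-- `U(1) →* U(Unit)`: a unit complex number as a `1 × 1` unitary matrix. [folklore] -/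
def unitaryToUnit : unitary ℂ →* Matrix.unitaryGroup Unit ℂ where
  toFun d := ⟨fun _ _ => (d : ℂ), by
    rw [Matrix.mem_unitaryGroup_iff']
    ext i j
    simpa [Matrix.mul_apply] using Unitary.coe_star_mul_self d⟩
  map_one' := by ext i j; rfl
  map_mul' d d' := by ext i j; simp [Matrix.mul_apply]

/-- Entries of `unitaryToUnit d`: all equal to `d`. [folklore] -/
@[simp] theorem coe_unitaryToUnit_apply (d : unitary ℂ) (i j : Unit) :
    (unitaryToUnit d : Matrix Unit Unit ℂ) i j = (d : ℂ) := rfl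

/-- `det (d) = d` for the `1 × 1` unitary matrix `unitaryToUnit d`. [folklore] -/
@[simp] theorem det_unitaryToUnit (d : unitary ℂ) : (unitaryToUnit d : Matrix Unit Unit ℂ).det = (d : ℂ) := by
  rw [Matrix.det_unique]; rfl

/-- **The frame carries the ball model's maximal compact to the junction's: `u21FrameEquiv (diag(A,d)) = kV (A, (d))`.**
[cite: KonnoKonno2007, §3.1] -/
theorem u21FrameEquiv_blockU (k : K21) :
    u21FrameEquiv (blockU k) = UForm.kV (Fin 2) Unit (k.1, unitaryToUnit k.2) := by
  apply Subtype.ext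
  apply Units.ext
  rw [coe_u21FrameEquiv, UForm.coe_kV, mat_blockU]
  ext (i | i) (j | j)
  · fin_cases i <;> fin_cases j <;> simp [bmat, matA]
  · fin_cases i <;> simp [bmat]
  · fin_cases j <;> simp [bmat]
  · simp [bmat, sclD]

/-- The same on the stabiliser: `u21FrameEquiv (blockK k) = kV (k.1, unitaryToUnit k.2)`. [cite: KonnoKonno2007, §3.1] -/
theorem u21FrameEquiv_blockK (k : K21) :
    u21FrameEquiv ((blockK k : MulAction.stabilizer U21 x₀) : U21) = UForm.kV (Fin 2) Unit (k.1, unitaryToUnit k.2) := by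
  rw [coe_blockK, u21FrameEquiv_blockU]

/-- On an arbitrary element `u` of the stabiliser, through `stabilizerEquivK21 : U(2) × U(1) ≃* Stab(x₀)`:
`u21FrameEquiv u = kV (A(u), (d(u)))`. [cite: KonnoKonno2007, §3.1] -/
theorem u21FrameEquiv_stabilizer (u : MulAction.stabilizer U21 x₀) :
    u21FrameEquiv (u : U21) =
      UForm.kV (Fin 2) Unit ((stabilizerEquivK21.symm u).1, unitaryToUnit (stabilizerEquivK21.symm u).2) := by
  conv_lhs => rw [← stabilizerEquivK21.apply_symm_apply u]
  exact u21FrameEquiv_blockK _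

end RealDualPair

end Literature.RepresentationTheory.KonnoKonno2007
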